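import Literature.NumberTheory.LFunctions.ConreyIwaniec2002SpacingMechanism
import Literature.NumberTheory.LFunctions.HalfIsolatedZeroDerivBounds
import Mathlib.Analysis.SpecialFunctions.SmoothTransition
import HarnessLib

/-!
# Conrey–Iwaniec (2002), §8: a cut-off of the class (6.38) for the range `n ≫ T`

B. Conrey, H. Iwaniec, *Spacing of zeros of Hecke L-functions and the class number problem*,
Acta Arith. 103 (2002), §6 (6.38) and §8 (8.5)–(8.7) [held text `paper:arxiv-math_0111012`, p0016
L40–47, p0018 L136–160].

In §8 the sums `A_{13}, A_{23}, A_{33}` (the range `n ≫ T` of a smooth partition) are estimated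
through Proposition 5.4 and then Proposition 6.4, whose hypothesis is that the coefficients are
`a(n)λ(n)` with `a` in the class (6.38): `a ∈ 𝒞²(ℝ⁺)`, `y^ν|a^{(ν)}(y)| ≤ (1 + y/Y + T/y)^{−4}`
(`ν = 0,1,2`), `Y = qT` (the tree's `ConreyIwaniec2002.IsCutoff a T (qT)`). This file builds ONE
explicit such cut-off adapted to the partition at `n ≍ T`:
  `a(y) = c₀ · η(y/T − 1) · (1 + y/(qT))^{−4}`, `η` = Mathlib's `Real.smoothTransition`
(`a = 0` for `y ≤ T`, `a = c₀(1 + y/qT)^{−4}` for `y ≥ 2T`), with an ABSOLUTE `c₀ > 0`, and proves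
that it lies in `IsCutoff · T′ (qT′)` for EVERY `T′ ∈ [T/2, 2T]` (`exists_tailCutoff`): the three
windows `[T/2,T]`, `[T,2T]`, `[2T,4T]` on which (6.52) is applied (Proposition 5.4's kernel
`K(t/T) ≥ 1` on `[1/2, 3]`). The derivative bounds of `η` (`exists_smoothTransition_deriv_bounds`)
come from compactness (the endpoint-vanishing helpers are reused from
`HalfIsolatedZeroDerivBounds`). Everything PROVED; no definition.

«The programme SEARCHES and TYPES; no claim about Landau–Siegel zeros until a kernel theorem says so.»

## References
* [ConreyIwaniec2002] B. Conrey, H. Iwaniec, Acta Arith. 103 (2002) 259–312, arXiv:math/0111012: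
  §6 (6.38), Proposition 6.4 (6.52); §8 (8.5)–(8.7).
-/

noncomputable section

open Complex Filter Set Real
open scoped Topology ContDiff

namespace Literature.NumberTheory.LFunctions

namespace ConreyIwaniec2002

/-! ## §1. Derivative bounds for `Real.smoothTransition` -/

/-- **Derivative bounds for the smooth transition `η`**: `η′, η″` are bounded on `ℝ` and vanish off
the open interval `(0, 1)`. [cite: ConreyIwaniec2002, §8 (8.5)] -/
theorem exists_smoothTransition_deriv_bounds :
    ∃ C₁ C₂ : ℝ, 0 ≤ C₁ ∧ 0 ≤ C₂ ∧
      (∀ x, |deriv Real.smoothTransition x| ≤ C₁) ∧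
      (∀ x, |deriv (deriv Real.smoothTransition) x| ≤ C₂) ∧
      (∀ x, (x ≤ 0 ∨ 1 ≤ x) →
        deriv Real.smoothTransition x = 0 ∧ deriv (deriv Real.smoothTransition) x = 0) := by
  set η := Real.smoothTransition with hη
  have hC : ContDiff ℝ ∞ η := Real.smoothTransition.contDiff
  have hC1 : ContDiff ℝ ∞ (deriv η) := by simpa using hC.iterate_deriv 1
  have hC0 : ContDiff ℝ ∞ (deriv (deriv η)) := by simpa using hC1.iterate_deriv 1
  have hc1 : Continuous (deriv η) := hC1.continuous
  have hc2 : Continuous (deriv (deriv η)) := hC0.continuous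
  -- vanishing off `(0,1)`
  have hz1 : ∀ x, x < 0 → deriv η x = 0 := by
    intro x hx
    have hev : η =ᶠ[𝓝 x] fun _ => (0 : ℝ) := by
      filter_upwards [Iio_mem_nhds hx] with y hy
      exact Real.smoothTransition.zero_of_nonpos (Set.mem_Iio.mp hy).le
    rw [hev.deriv_eq, deriv_const]
  have ho1 : ∀ x, 1 < x → deriv η x = 0 := by
    intro x hx
    have hev : η =ᶠ[𝓝 x] fun _ => (1 : ℝ) := by
      filter_upwards [Ioi_mem_nhds hx] with y hy
      exact Real.smoothTransition.one_of_one_le (Set.mem_Ioi.mp hy).le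
    rw [hev.deriv_eq, deriv_const]
  have hz2 : ∀ x, x < 0 → deriv (deriv η) x = 0 := by
    intro x hx
    have hev : deriv η =ᶠ[𝓝 x] fun _ => (0 : ℝ) := by
      filter_upwards [Iio_mem_nhds hx] with y hy
      exact hz1 y (Set.mem_Iio.mp hy)
    rw [hev.deriv_eq, deriv_const]
  have ho2 : ∀ x, 1 < x → deriv (deriv η) x = 0 := by
    intro x hx
    have hev : deriv η =ᶠ[𝓝 x] fun _ => (0 : ℝ) := by
      filter_upwards [Ioi_mem_nhds hx] with y hy
      exact ho1 y (Set.mem_Ioi.mp hy)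
    rw [hev.deriv_eq, deriv_const]
  have hzero : ∀ x, (x ≤ 0 ∨ 1 ≤ x) → deriv η x = 0 ∧ deriv (deriv η) x = 0 := by
    intro x hx
    rcases hx with hx | hx
    · rcases hx.lt_or_eq with hx | hx
      · exact ⟨hz1 x hx, hz2 x hx⟩
      · rw [hx]
        exact ⟨MaynardPratt.eq_zero_of_eqOn_Iio hc1 hz1, MaynardPratt.eq_zero_of_eqOn_Iio hc2 hz2⟩
    · rcases hx.lt_or_eq with hx | hx
      · exact ⟨ho1 x hx, ho2 x hx⟩
      · rw [← hx]
        exact ⟨MaynardPratt.eq_zero_of_eqOn_Ioi hc1 ho1, MaynardPratt.eq_zero_of_eqOn_Ioi hc2 ho2⟩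
  -- bounds by compactness on `[0, 1]`
  obtain ⟨B₁, hB₁⟩ := isCompact_Icc.exists_bound_of_continuousOn (s := Set.Icc (0 : ℝ) 1)
    hc1.continuousOn
  obtain ⟨B₂, hB₂⟩ := isCompact_Icc.exists_bound_of_continuousOn (s := Set.Icc (0 : ℝ) 1)
    hc2.continuousOn
  refine ⟨max B₁ 0, max B₂ 0, le_max_right _ _, le_max_right _ _, ?_, ?_, hzero⟩
  · intro x
    by_cases hx : x ∈ Set.Icc (0 : ℝ) 1
    · exact le_trans (by simpa [Real.norm_eq_abs] using hB₁ x hx) (le_max_left _ _)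
    · rw [Set.mem_Icc, not_and_or, not_le, not_le] at hx
      have : deriv η x = 0 := (hzero x (by rcases hx with h | h; exact Or.inl h.le; exact Or.inr h.le)).1
      rw [this, abs_zero]; exact le_max_right _ _
  · intro x
    by_cases hx : x ∈ Set.Icc (0 : ℝ) 1
    · exact le_trans (by simpa [Real.norm_eq_abs] using hB₂ x hx) (le_max_left _ _)
    · rw [Set.mem_Icc, not_and_or, not_le, not_le] at hx
      have : deriv (deriv η) x = 0 := (hzero x (by rcases hx with h | h; exact Or.inl h.le; exact Or.inr h.le)).2
      rw [this, abs_zero]; exact le_max_right _ _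

/-! ## §2. The cut-off and its first two derivatives -/

/-- The reciprocal factor `r(y) = (1 + y/Y)^{−1}` has derivative `−r²/Y` where `1 + y/Y ≠ 0`.
[cite: ConreyIwaniec2002, §6 (6.38)] -/
theorem hasDerivAt_inv_one_add_div {Y y : ℝ} (hY : 0 < Y) (hy : 0 < 1 + y / Y) :
    HasDerivAt (fun y : ℝ => (1 + y / Y)⁻¹) (-((1 + y / Y)⁻¹ ^ 2) / Y) y := by
  have h1 : HasDerivAt (fun y : ℝ => 1 + y / Y) (1 / Y) y := by
    simpa using ((hasDerivAt_id y).div_const Y).const_add 1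
  have h2 := h1.inv hy.ne'
  refine h2.congr_deriv ?_
  rw [inv_pow]
  field_simp

/-- **The first derivative of the cut-off** `f(y) = η(y/T − 1)·(1 + y/Y)^{−4}` at `y` with
`1 + y/Y > 0`: `f′ = η′(u) r⁴/T − (4/Y) η(u) r⁵`, `u = y/T − 1`, `r = (1+y/Y)^{−1}`.
[cite: ConreyIwaniec2002, §8 (8.5)] -/
theorem hasDerivAt_cutoff {T Y y : ℝ} (hY : 0 < Y) (hy : 0 < 1 + y / Y) :
    HasDerivAt (fun y : ℝ => Real.smoothTransition (y / T - 1) * ((1 + y / Y)⁻¹) ^ 4)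
      (deriv Real.smoothTransition (y / T - 1) / T * ((1 + y / Y)⁻¹) ^ 4 -
        4 / Y * Real.smoothTransition (y / T - 1) * ((1 + y / Y)⁻¹) ^ 5) y := by
  have hη : Differentiable ℝ Real.smoothTransition :=
    (Real.smoothTransition.contDiff (n := 1)).differentiable (by norm_num)
  have hu : HasDerivAt (fun y : ℝ => y / T - 1) (1 / T) y := by
    simpa using ((hasDerivAt_id y).div_const T).sub_const 1
  have h1 : HasDerivAt (fun y : ℝ => Real.smoothTransition (y / T - 1))
      (deriv Real.smoothTransition (y / T - 1) * (1 / T)) y := by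
    have h := (hη (y / T - 1)).hasDerivAt.comp y hu
    simpa [Function.comp_def] using h
  have h2 : HasDerivAt (fun y : ℝ => ((1 + y / Y)⁻¹) ^ 4)
      (((4 : ℕ) : ℝ) * ((1 + y / Y)⁻¹) ^ (4 - 1) * (-((1 + y / Y)⁻¹ ^ 2) / Y)) y :=
    (hasDerivAt_inv_one_add_div hY hy).fun_pow 4
  have h := h1.fun_mul h2
  refine h.congr_deriv ?_
  rw [show (4 : ℕ) - 1 = 3 from rfl]
  push_cast
  ring

/-- **The second derivative of the cut-off** at `y` with `1 + y/Y > 0`: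
`f″ = η″(u) r⁴/T² − (8/(TY)) η′(u) r⁵ + (20/Y²) η(u) r⁶`. [cite: ConreyIwaniec2002, §8 (8.5)] -/
theorem hasDerivAt_cutoff_deriv {T Y y : ℝ} (hT : 0 < T) (hY : 0 < Y) (hy : 0 < 1 + y / Y) :
    HasDerivAt (fun y : ℝ => deriv Real.smoothTransition (y / T - 1) / T * ((1 + y / Y)⁻¹) ^ 4 -
        4 / Y * Real.smoothTransition (y / T - 1) * ((1 + y / Y)⁻¹) ^ 5)
      (deriv (deriv Real.smoothTransition) (y / T - 1) / T ^ 2 * ((1 + y / Y)⁻¹) ^ 4 -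
        8 / (T * Y) * deriv Real.smoothTransition (y / T - 1) * ((1 + y / Y)⁻¹) ^ 5 +
        20 / Y ^ 2 * Real.smoothTransition (y / T - 1) * ((1 + y / Y)⁻¹) ^ 6) y := by
  have hη : Differentiable ℝ Real.smoothTransition :=
    (Real.smoothTransition.contDiff (n := 1)).differentiable (by norm_num)
  have hηinf : ContDiff ℝ ∞ Real.smoothTransition := Real.smoothTransition.contDiff
  have hη'C : ContDiff ℝ ∞ (deriv Real.smoothTransition) := by simpa using hηinf.iterate_deriv 1
  have hη' : Differentiable ℝ (deriv Real.smoothTransition) := hη'C.differentiable (by simp)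
  have hu : HasDerivAt (fun y : ℝ => y / T - 1) (1 / T) y := by
    simpa using ((hasDerivAt_id y).div_const T).sub_const 1
  have h1 : HasDerivAt (fun y : ℝ => deriv Real.smoothTransition (y / T - 1))
      (deriv (deriv Real.smoothTransition) (y / T - 1) * (1 / T)) y := by
    have h := (hη' (y / T - 1)).hasDerivAt.comp y hu
    simpa [Function.comp_def] using h
  have h1' : HasDerivAt (fun y : ℝ => deriv Real.smoothTransition (y / T - 1) / T)
      (deriv (deriv Real.smoothTransition) (y / T - 1) * (1 / T) / T) y := h1.div_const T
  have h0 : HasDerivAt (fun y : ℝ => Real.smoothTransition (y / T - 1))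
      (deriv Real.smoothTransition (y / T - 1) * (1 / T)) y := by
    have h := (hη (y / T - 1)).hasDerivAt.comp y hu
    simpa [Function.comp_def] using h
  have hr := hasDerivAt_inv_one_add_div hY hy
  have h4 : HasDerivAt (fun y : ℝ => ((1 + y / Y)⁻¹) ^ 4)
      (((4 : ℕ) : ℝ) * ((1 + y / Y)⁻¹) ^ (4 - 1) * (-((1 + y / Y)⁻¹ ^ 2) / Y)) y := hr.fun_pow 4
  have h5 : HasDerivAt (fun y : ℝ => ((1 + y / Y)⁻¹) ^ 5)
      (((5 : ℕ) : ℝ) * ((1 + y / Y)⁻¹) ^ (5 - 1) * (-((1 + y / Y)⁻¹ ^ 2) / Y)) y := hr.fun_pow 5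
  have hA := h1'.fun_mul h4
  have hB := (h0.const_mul (4 / Y)).fun_mul h5
  have h := hA.sub hB
  refine h.congr_deriv ?_
  rw [show (4 : ℕ) - 1 = 3 from rfl, show (5 : ℕ) - 1 = 4 from rfl]
  push_cast
  field_simp
  ring

/-! ## §3. The cut-off lies in the class (6.38) on all three windows -/

/-- **Bounds for the cut-off and its first two (scaled) derivatives on `y ≥ T`**: with
`r = (1 + y/Y)^{−1}`, `K = 4C₂ + 16C₁ + 24` (`C₁, C₂` bounds for `η′, η″`),
`|f(y)|, y|f′(y)|, y²|f″(y)| ≤ K r⁴` for `f(y) = η(y/T − 1)(1+y/Y)^{−4}`.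
[cite: ConreyIwaniec2002, §6 (6.38), §8 (8.5)] -/
theorem cutoff_bounds_of_le {C₁ C₂ T Y y : ℝ} (hC₁ : 0 ≤ C₁) (hC₂ : 0 ≤ C₂) (hT : 0 < T) (hY : 0 < Y)
    (hy : 0 < y) (hyT' : T ≤ y)
    (hd1 : ∀ x, |deriv Real.smoothTransition x| ≤ C₁)
    (hd2 : ∀ x, |deriv (deriv Real.smoothTransition) x| ≤ C₂)
    (hzero : ∀ x, (x ≤ 0 ∨ 1 ≤ x) →
      deriv Real.smoothTransition x = 0 ∧ deriv (deriv Real.smoothTransition) x = 0) :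
    |Real.smoothTransition (y / T - 1) * ((1 + y / Y)⁻¹) ^ 4| ≤
        (4 * C₂ + 16 * C₁ + 24) * ((1 + y / Y)⁻¹) ^ 4 ∧
    y * |deriv Real.smoothTransition (y / T - 1) / T * ((1 + y / Y)⁻¹) ^ 4 -
        4 / Y * Real.smoothTransition (y / T - 1) * ((1 + y / Y)⁻¹) ^ 5| ≤
        (4 * C₂ + 16 * C₁ + 24) * ((1 + y / Y)⁻¹) ^ 4 ∧
    y ^ 2 * |deriv (deriv Real.smoothTransition) (y / T - 1) / T ^ 2 * ((1 + y / Y)⁻¹) ^ 4 -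
        8 / (T * Y) * deriv Real.smoothTransition (y / T - 1) * ((1 + y / Y)⁻¹) ^ 5 +
        20 / Y ^ 2 * Real.smoothTransition (y / T - 1) * ((1 + y / Y)⁻¹) ^ 6| ≤
        (4 * C₂ + 16 * C₁ + 24) * ((1 + y / Y)⁻¹) ^ 4 := by
  set η := Real.smoothTransition with hηdef
  set K : ℝ := 4 * C₂ + 16 * C₁ + 24 with hK
  set f : ℝ → ℝ := fun y => η (y / T - 1) * ((1 + y / Y)⁻¹) ^ 4 with hf
  set f₁ : ℝ → ℝ := fun y => deriv η (y / T - 1) / T * ((1 + y / Y)⁻¹) ^ 4 -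
    4 / Y * η (y / T - 1) * ((1 + y / Y)⁻¹) ^ 5 with hf₁
  set f₂ : ℝ → ℝ := fun y => deriv (deriv η) (y / T - 1) / T ^ 2 * ((1 + y / Y)⁻¹) ^ 4 -
    8 / (T * Y) * deriv η (y / T - 1) * ((1 + y / Y)⁻¹) ^ 5 +
    20 / Y ^ 2 * η (y / T - 1) * ((1 + y / Y)⁻¹) ^ 6 with hf₂
  change |f y| ≤ K * ((1 + y / Y)⁻¹) ^ 4 ∧ y * |f₁ y| ≤ K * ((1 + y / Y)⁻¹) ^ 4 ∧
    y ^ 2 * |f₂ y| ≤ K * ((1 + y / Y)⁻¹) ^ 4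
  have hpos : 0 < 1 + y / Y := by positivity
  have hη01 : ∀ x, 0 ≤ η x ∧ η x ≤ 1 := fun x =>
    ⟨Real.smoothTransition.nonneg x, Real.smoothTransition.le_one x⟩
  set r : ℝ := (1 + y / Y)⁻¹ with hr
  have hr0 : 0 < r := inv_pos.mpr hpos
  have hr1 : r ≤ 1 := by
    rw [hr]
    apply inv_le_one_of_one_le₀
    have : 0 ≤ y / Y := by positivity
    linarith
  have hyr : y / Y * r ≤ 1 := by
    rw [hr, ← div_eq_mul_inv, div_le_one hpos]
    linarith

  -- where `η′, η″` do not vanish we have `y ≤ 2T`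
  have hsupp : deriv η (y / T - 1) ≠ 0 ∨ deriv (deriv η) (y / T - 1) ≠ 0 → y / T ≤ 2 := by
    intro h
    by_contra hcon
    push Not at hcon
    have : 1 ≤ y / T - 1 := by linarith
    have hz := hzero (y / T - 1) (Or.inr this)
    rcases h with h | h
    · exact h hz.1
    · exact h hz.2
  -- bounds `y^ν |f^{(ν)}| ≤ K r^4`
  have hb0 : |f y| ≤ K * r ^ 4 := by
    simp only [hf]
    rw [abs_mul, abs_of_nonneg (hη01 _).1, abs_of_nonneg (by positivity)]
    calc η (y / T - 1) * r ^ 4 ≤ 1 * r ^ 4 :=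
          mul_le_mul_of_nonneg_right (hη01 _).2 (by positivity)
      _ ≤ K * r ^ 4 := mul_le_mul_of_nonneg_right (by rw [hK]; linarith) (by positivity)
  have hyT1 : 1 ≤ y / T := by rwa [le_div_iff₀ hT, one_mul]
  have hb1 : y * |f₁ y| ≤ K * r ^ 4 := by
    -- `y|f₁| ≤ (y/T)|η′| r⁴ + 4 (y r/Y) η r⁴`
    have e1 : y * f₁ y = (y / T) * deriv η (y / T - 1) * r ^ 4 -
        4 * (y / Y * r) * η (y / T - 1) * r ^ 4 := by
      simp only [hf₁, hr]; field_simp; try ring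
    have hA : |(y / T) * deriv η (y / T - 1) * r ^ 4| ≤ 2 * C₁ * r ^ 4 := by
      by_cases hz : deriv η (y / T - 1) = 0
      · rw [hz, mul_zero, zero_mul, abs_zero]; positivity
      · have hy2 := hsupp (Or.inl hz)
        rw [abs_mul, abs_mul, abs_of_nonneg (by positivity : 0 ≤ y / T),
          abs_of_nonneg (by positivity : 0 ≤ r ^ 4)]
        have h1 : y / T * |deriv η (y / T - 1)| ≤ 2 * C₁ :=
          mul_le_mul hy2 (hd1 _) (abs_nonneg _) (by norm_num)
        exact mul_le_mul_of_nonneg_right h1 (by positivity)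
    have hB : |4 * (y / Y * r) * η (y / T - 1) * r ^ 4| ≤ 4 * r ^ 4 := by
      rw [abs_of_nonneg (by have := (hη01 (y / T - 1)).1; positivity)]
      have h1 : 4 * (y / Y * r) * η (y / T - 1) ≤ 4 := by
        have h2 : (y / Y * r) * η (y / T - 1) ≤ 1 * 1 :=
          mul_le_mul hyr (hη01 _).2 (hη01 _).1 zero_le_one
        linarith
      exact mul_le_mul_of_nonneg_right h1 (by positivity)
    have habs : y * |f₁ y| = |y * f₁ y| := by rw [abs_mul, abs_of_nonneg hy.le]
    rw [habs, e1]
    calc |(y / T) * deriv η (y / T - 1) * r ^ 4 - 4 * (y / Y * r) * η (y / T - 1) * r ^ 4|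
        ≤ |(y / T) * deriv η (y / T - 1) * r ^ 4| + |4 * (y / Y * r) * η (y / T - 1) * r ^ 4| :=
          abs_sub _ _
      _ ≤ 2 * C₁ * r ^ 4 + 4 * r ^ 4 := add_le_add hA hB
      _ ≤ K * r ^ 4 := by
          rw [hK]; have h4 : 0 ≤ r ^ 4 := pow_nonneg hr0.le 4
          linarith [mul_nonneg hC₁ h4, mul_nonneg hC₂ h4]
  have hb2 : y ^ 2 * |f₂ y| ≤ K * r ^ 4 := by
    have e2 : y ^ 2 * f₂ y = (y / T) ^ 2 * deriv (deriv η) (y / T - 1) * r ^ 4 -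
        8 * (y / T) * (y / Y * r) * deriv η (y / T - 1) * r ^ 4 +
        20 * (y / Y * r) ^ 2 * η (y / T - 1) * r ^ 4 := by
      simp only [hf₂, hr]; field_simp; try ring
    have hA : |(y / T) ^ 2 * deriv (deriv η) (y / T - 1) * r ^ 4| ≤ 4 * C₂ * r ^ 4 := by
      by_cases hz : deriv (deriv η) (y / T - 1) = 0
      · rw [hz, mul_zero, zero_mul, abs_zero]; positivity
      · have hy2 := hsupp (Or.inr hz)
        rw [abs_mul, abs_mul, abs_of_nonneg (by positivity : 0 ≤ (y / T) ^ 2),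
          abs_of_nonneg (by positivity : 0 ≤ r ^ 4)]
        have hsq : (y / T) ^ 2 ≤ 4 := by nlinarith
        have h1 : (y / T) ^ 2 * |deriv (deriv η) (y / T - 1)| ≤ 4 * C₂ :=
          mul_le_mul hsq (hd2 _) (abs_nonneg _) (by norm_num)
        exact mul_le_mul_of_nonneg_right h1 (by positivity)
    have hB : |8 * (y / T) * (y / Y * r) * deriv η (y / T - 1) * r ^ 4| ≤ 16 * C₁ * r ^ 4 := by
      by_cases hz : deriv η (y / T - 1) = 0
      · rw [hz, mul_zero, zero_mul, abs_zero]; positivity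
      · have hy2 := hsupp (Or.inl hz)
        rw [abs_mul, abs_of_nonneg (by positivity : 0 ≤ r ^ 4), abs_mul,
          abs_of_nonneg (by positivity : 0 ≤ 8 * (y / T) * (y / Y * r))]
        have h1 : 8 * (y / T) * (y / Y * r) ≤ 16 := by
          have : (y / T) * (y / Y * r) ≤ 2 * 1 := mul_le_mul hy2 hyr (by positivity) (by norm_num)
          linarith
        have h2 : 8 * (y / T) * (y / Y * r) * |deriv η (y / T - 1)| ≤ 16 * C₁ :=
          mul_le_mul h1 (hd1 _) (abs_nonneg _) (by norm_num)
        exact mul_le_mul_of_nonneg_right h2 (by positivity)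
    have hC : |20 * (y / Y * r) ^ 2 * η (y / T - 1) * r ^ 4| ≤ 20 * r ^ 4 := by
      rw [abs_of_nonneg (by have := (hη01 (y / T - 1)).1; positivity)]
      have hsq : (y / Y * r) ^ 2 ≤ 1 := by
        have h0 : 0 ≤ y / Y * r := by positivity
        nlinarith
      have h1 : 20 * (y / Y * r) ^ 2 * η (y / T - 1) ≤ 20 := by
        have h2 : (y / Y * r) ^ 2 * η (y / T - 1) ≤ 1 * 1 :=
          mul_le_mul hsq (hη01 _).2 (hη01 _).1 zero_le_one
        linarith
      exact mul_le_mul_of_nonneg_right h1 (by positivity)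
    have habs : y ^ 2 * |f₂ y| = |y ^ 2 * f₂ y| := by rw [abs_mul, abs_of_nonneg (sq_nonneg y)]
    rw [habs, e2]
    calc |(y / T) ^ 2 * deriv (deriv η) (y / T - 1) * r ^ 4 -
          8 * (y / T) * (y / Y * r) * deriv η (y / T - 1) * r ^ 4 +
          20 * (y / Y * r) ^ 2 * η (y / T - 1) * r ^ 4|
        ≤ |(y / T) ^ 2 * deriv (deriv η) (y / T - 1) * r ^ 4 -
            8 * (y / T) * (y / Y * r) * deriv η (y / T - 1) * r ^ 4| +
          |20 * (y / Y * r) ^ 2 * η (y / T - 1) * r ^ 4| := abs_add_le _ _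
      _ ≤ (|(y / T) ^ 2 * deriv (deriv η) (y / T - 1) * r ^ 4| +
            |8 * (y / T) * (y / Y * r) * deriv η (y / T - 1) * r ^ 4|) +
          |20 * (y / Y * r) ^ 2 * η (y / T - 1) * r ^ 4| := by
          gcongr; exact abs_sub _ _
      _ ≤ (4 * C₂ * r ^ 4 + 16 * C₁ * r ^ 4) + 20 * r ^ 4 := by gcongr
      _ ≤ K * r ^ 4 := by
          rw [hK]; have h4 : 0 ≤ r ^ 4 := pow_nonneg hr0.le 4
          linarith [mul_nonneg hC₁ h4, mul_nonneg hC₂ h4]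
  exact ⟨hb0, hb1, hb2⟩

/-- **A cut-off of the class (6.38) for the range `n ≫ T`.** There is an absolute `c₀ > 0` such
that for all real `q ≥ 1`, `T > 0` and every `T′ ∈ [T/2, 2T]`, the function
`a(y) = c₀ · η(y/T − 1) · (1 + y/(qT))^{−4}` (`η` = `Real.smoothTransition`; `a = 0` on `y ≤ T`,
`a = c₀(1 + y/qT)^{−4}` on `y ≥ 2T`) satisfies (6.38) with parameters `T′`, `Y = qT′`:
`a ∈ 𝒞²(ℝ⁺)`, `y^ν|a^{(ν)}(y)| ≤ (1 + y/(qT′) + T′/y)^{−4}` for `ν ≤ 2` — i.e. the tree's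
`IsCutoff a T′ (qT′)`, so that Proposition 6.4 (6.52) applies on `[T/2, T]`, `[T, 2T]`, `[2T, 4T]`
with the SAME coefficients. [cite: ConreyIwaniec2002, §6 (6.38), §8 (8.5)–(8.7)] -/
theorem exists_tailCutoff :
    ∃ c₀ : ℝ, 0 < c₀ ∧ c₀ ≤ 1 ∧ ∀ (q T T' : ℝ), 1 ≤ q → 0 < T → T / 2 ≤ T' → T' ≤ 2 * T →
      IsCutoff (fun y : ℝ => ((c₀ * (Real.smoothTransition (y / T - 1) * ((1 + y / (q * T))⁻¹) ^ 4)
        : ℝ) : ℂ)) T' (q * T') := by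
  obtain ⟨C₁, C₂, hC₁, hC₂, hd1, hd2, hzero⟩ := exists_smoothTransition_deriv_bounds
  set K : ℝ := 4 * C₂ + 16 * C₁ + 24 with hK
  have hK0 : 0 < K := by positivity
  refine ⟨1 / (81 * K), by positivity, ?_, fun q T T' hq hT hT'1 hT'2 => ?_⟩
  · rw [div_le_one (by positivity)]; nlinarith
  set c₀ : ℝ := 1 / (81 * K) with hc₀
  have hc₀0 : 0 < c₀ := by positivity
  set Y : ℝ := q * T with hYdef
  have hY : 0 < Y := by positivity
  have hT' : 0 < T' := by linarith
  set η := Real.smoothTransition with hηdef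
  -- the real cut-off and its derivatives
  set f : ℝ → ℝ := fun y => η (y / T - 1) * ((1 + y / Y)⁻¹) ^ 4 with hf
  set f₁ : ℝ → ℝ := fun y => deriv η (y / T - 1) / T * ((1 + y / Y)⁻¹) ^ 4 -
    4 / Y * η (y / T - 1) * ((1 + y / Y)⁻¹) ^ 5 with hf₁
  set f₂ : ℝ → ℝ := fun y => deriv (deriv η) (y / T - 1) / T ^ 2 * ((1 + y / Y)⁻¹) ^ 4 -
    8 / (T * Y) * deriv η (y / T - 1) * ((1 + y / Y)⁻¹) ^ 5 +
    20 / Y ^ 2 * η (y / T - 1) * ((1 + y / Y)⁻¹) ^ 6 with hf₂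
  have hpos : ∀ y : ℝ, 0 < y → 0 < 1 + y / Y := fun y hy => by positivity
  have hdf : ∀ y, 0 < y → HasDerivAt f (f₁ y) y := fun y hy => hasDerivAt_cutoff hY (hpos y hy)
  have hdf₁ : ∀ y, 0 < y → HasDerivAt f₁ (f₂ y) y := fun y hy =>
    hasDerivAt_cutoff_deriv hT hY (hpos y hy)
  -- the complex cut-off `a = c₀ f` and its iterated derivatives on `y > 0`
  set a : ℝ → ℂ := fun y => ((c₀ * (η (y / T - 1) * ((1 + y / Y)⁻¹) ^ 4) : ℝ) : ℂ) with ha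
  have ha' : a = fun y => ((c₀ * f y : ℝ) : ℂ) := rfl
  have hda : ∀ y, 0 < y → HasDerivAt a ((c₀ * f₁ y : ℝ) : ℂ) y := fun y hy => by
    rw [ha']; exact ((hdf y hy).const_mul c₀).ofReal_comp
  have hderiv_a : ∀ y, 0 < y → deriv a y = ((c₀ * f₁ y : ℝ) : ℂ) := fun y hy => (hda y hy).deriv
  have hda₁ : ∀ y, 0 < y → HasDerivAt (deriv a) ((c₀ * f₂ y : ℝ) : ℂ) y := by
    intro y hy
    have hev : deriv a =ᶠ[𝓝 y] fun z => ((c₀ * f₁ z : ℝ) : ℂ) := by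
      filter_upwards [Ioi_mem_nhds hy] with z hz
      exact hderiv_a z (Set.mem_Ioi.mp hz)
    refine HasDerivAt.congr_of_eventuallyEq ?_ hev
    exact ((hdf₁ y hy).const_mul c₀).ofReal_comp
  have hiter0 : ∀ y, iteratedDeriv 0 a y = ((c₀ * f y : ℝ) : ℂ) := fun y => by
    rw [iteratedDeriv_zero]
  have hiter1 : ∀ y, 0 < y → iteratedDeriv 1 a y = ((c₀ * f₁ y : ℝ) : ℂ) := fun y hy => by
    rw [iteratedDeriv_one]; exact hderiv_a y hy
  have hiter2 : ∀ y, 0 < y → iteratedDeriv 2 a y = ((c₀ * f₂ y : ℝ) : ℂ) := fun y hy => by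
    rw [iteratedDeriv_succ, iteratedDeriv_one]; exact (hda₁ y hy).deriv
  -- smoothness on `(0, ∞)`
  have hcd : ContDiffOn ℝ 2 a (Set.Ioi 0) := by
    have hηC : ContDiff ℝ 2 η := Real.smoothTransition.contDiff
    have h1 : ContDiff ℝ 2 (fun y : ℝ => η (y / T - 1)) := hηC.comp (by fun_prop)
    have h2 : ContDiffOn ℝ 2 (fun y : ℝ => ((1 + y / Y)⁻¹) ^ 4) (Set.Ioi 0) := by
      refine ContDiffOn.pow (ContDiffOn.inv (by fun_prop) fun y hy => (hpos y hy).ne') 4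
    have h3 : ContDiffOn ℝ 2 (fun y => c₀ * (η (y / T - 1) * ((1 + y / Y)⁻¹) ^ 4)) (Set.Ioi 0) :=
      contDiffOn_const.mul (h1.contDiffOn.mul h2)
    rw [ha]
    exact Complex.ofRealCLM.contDiff.comp_contDiffOn h3
  -- elementary bounds
  have hη01 : ∀ x, 0 ≤ η x ∧ η x ≤ 1 := fun x =>
    ⟨Real.smoothTransition.nonneg x, Real.smoothTransition.le_one x⟩
  refine ⟨hcd, fun ν hν y hy => ?_⟩
  set r : ℝ := (1 + y / Y)⁻¹ with hr
  have hr0 : 0 < r := inv_pos.mpr (hpos y hy)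
  have hr1 : r ≤ 1 := by
    rw [hr]
    apply inv_le_one_of_one_le₀
    have : 0 ≤ y / Y := by positivity
    linarith
  have hyr : y / Y * r ≤ 1 := by
    rw [hr, ← div_eq_mul_inv, div_le_one (hpos y hy)]
    linarith
  -- the class bound dominates `r⁴/81` on `y ≥ T`, and everything vanishes on `y ≤ T`
  have hclass : y ≥ T → r ^ 4 / 81 ≤ ((1 + y / (q * T') + T' / y) ^ 4)⁻¹ := by
    intro hyT
    have h1 : 1 + y / (q * T') + T' / y ≤ 3 / r := by
      have e1 : 3 / r = 3 * (1 + y / Y) := by rw [hr, div_inv_eq_mul]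
      rw [e1]
      have h2 : y / (q * T') ≤ 2 * (y / Y) := by
        rw [hYdef, div_le_iff₀ (by positivity)]
        have : 0 ≤ y / (q * T) := by positivity
        calc y = y / (q * T) * (q * T) := by field_simp
          _ ≤ y / (q * T) * (q * (2 * T')) := by gcongr; linarith
          _ = 2 * (y / (q * T)) * (q * T') := by ring
      have h3 : T' / y ≤ 2 := by
        rw [div_le_iff₀ hy]; linarith
      have h4 : 0 ≤ y / Y := by positivity
      linarith
    have h3r : 0 < 3 / r := by positivity
    have hbase : 0 < 1 + y / (q * T') + T' / y := by positivity
    calc r ^ 4 / 81 = ((3 / r) ^ 4)⁻¹ := by rw [div_pow, inv_div]; norm_num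
      _ ≤ ((1 + y / (q * T') + T' / y) ^ 4)⁻¹ := by
          apply inv_anti₀ (by positivity)
          exact pow_le_pow_left₀ hbase.le h1 4
  by_cases hyT : y ≤ T
  · -- below `T` the cut-off and its derivatives vanish
    have hu : y / T - 1 ≤ 0 := by rw [sub_nonpos, div_le_one hT]; exact hyT
    have hη0 : η (y / T - 1) = 0 := Real.smoothTransition.zero_of_nonpos hu
    have hd0 := hzero (y / T - 1) (Or.inl hu)
    have hval : iteratedDeriv ν a y = 0 := by
      obtain rfl | rfl | rfl : ν = 0 ∨ ν = 1 ∨ ν = 2 := by omega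
      · rw [hiter0]; simp [hf, hη0]
      · rw [hiter1 y hy]; simp [hf₁, hη0, hd0.1]
      · rw [hiter2 y hy]; simp [hf₂, hη0, hd0.1, hd0.2]
    rw [hval, norm_zero, mul_zero]; positivity
  · push Not at hyT
    have hyT' : T ≤ y := hyT.le
    obtain ⟨hb0, hb1, hb2⟩ := cutoff_bounds_of_le (Y := Y) hC₁ hC₂ hT hY hy hyT' hd1 hd2 hzero
    -- conclude: `y^ν |a^{(ν)}| = c₀ y^ν |f^{(ν)}| ≤ c₀ K r⁴ = r⁴/81 ≤ class bound`
    have hcK : c₀ * K = 1 / 81 := by rw [hc₀]; field_simp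
    have hfin : ∀ x : ℝ, y ^ ν * |x| ≤ K * r ^ 4 →
        y ^ ν * ‖((c₀ * x : ℝ) : ℂ)‖ ≤ ((1 + y / (q * T') + T' / y) ^ 4)⁻¹ := by
      intro x hx
      rw [Complex.norm_real, Real.norm_eq_abs, abs_mul, abs_of_pos hc₀0]
      calc y ^ ν * (c₀ * |x|) = c₀ * (y ^ ν * |x|) := by ring
        _ ≤ c₀ * (K * r ^ 4) := mul_le_mul_of_nonneg_left hx hc₀0.le
        _ = (c₀ * K) * r ^ 4 := by ring
        _ = r ^ 4 / 81 := by rw [hcK]; ring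
        _ ≤ _ := hclass hyT'
    obtain rfl | rfl | rfl : ν = 0 ∨ ν = 1 ∨ ν = 2 := by omega
    · rw [hiter0]; exact hfin _ (by rw [pow_zero, one_mul]; exact hb0)
    · rw [hiter1 y hy]; exact hfin _ (by rw [pow_one]; exact hb1)
    · rw [hiter2 y hy]; exact hfin _ hb2

end ConreyIwaniec2002

end Literature.NumberTheory.LFunctions

end
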